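import Summits.ResolutionOfSingularities.ResolutionOfSingularities.Theorems.HilbertSamuelEliminationSigmaMaxModificationsCorridor3WLadderE1DirectrixExceptional
import Summits.ResolutionOfSingularities.ResolutionOfSingularities.Theorems.HilbertSamuelEliminationSigmaMaxModificationsCorridor3HypersurfaceHilbertFunction
import Literature.RingTheory.HilbertSamuel.PhiLowerBound
import Literature.RingTheory.HilbertSamuel.TangentConeChangeOfGenerators
import Literature.RingTheory.HilbertSamuel.ProjDirectrixLiftsTransport
import Literature.RingTheory.HilbertSamuel.DirectrixLocal
import Literature.AlgebraicGeometry.Resolution.RegularLocalRingsProofs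
import HarnessLib

/-!
# [OURS · L1 W4.2] The `e = 1` door through the arc, step 2/3 — **the initial form of the strict transform of a hypersurface at
# the point `ℙ(Dir)`: `in(h′) = F(Y′) + U·G`, hence `U ∉ 𝒯(x′)`** (ring level; crux `SigmaMaxModifications`
# stmt-ResolutionOfSingularities-18506 / conjunct stmt-…-19249, line `w_ladder`, row `stub_Wlow3M_two` (β); `--supports 19249`, helper)

Stub worker res-L1-w42-stub-3 (gen 5). Sorry-free PROOF file, no definition, no named fact. OURS bookkeeping for the W4.2 crux chain
(cell res-hironaka); NOT a statement of [Hironaka2017] nor of [CossartJannsenSaito2020]. AI-written; AI review is weaker than expert review.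

SETTING (the output currency of res-type-071's `EmbeddedStep.exists_origin_presentation`, abstracted): `ι : R → R′` a local homomorphism of
regular local rings (downstairs / upstairs of one point blow-up), `c` a regular system of parameters of `R` with the exceptional slot `j₀`
(`t := c j₀`), `y′` a regular system of parameters of `R′` with `y′ j₀ = ι t` and `ι (c k) = ι t · y′ k` (`k ≠ j₀`) — the point upstairs is the
ORIGIN of the `t`-chart —, a hypersurface equation `h` of multiplicity `m ≥ 1` with strict transform `h′`: `ι h = (ι t)^m · h′`, and NEARNESS
`h′ ∈ 𝔪′^m` (from `H^{(0)}` constant, tree `mem_pow_and_not_mem_pow_succ_of_hilbertSamuelFun_eq`).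

* `E1Free.eval_mul_of_isHomogeneous` — `Φ(a·v) = a^m Φ(v)` for a form of degree `m` (any commutative ring).
* `E1Free.exists_add_X_mul_mem_initialFormsOf` — **LEMMA B**: if the initial form `F = in_c(h)` (degree `m`) involves only the variables
  `C_k`, `k ≠ j₀`, then `in_{y′}(h′) = F(Y′) + Y′_{j₀}·G` for some `G`: precisely `map κ F + X j₀ * G ∈ initialFormsOf y′ h′ m`
  (`κ = κ(R) → κ(R′)`). Proof: lift `F` with the same support, `h = Φ₀(c) + r₀`, `r₀ ∈ 𝔪^{m+1}` (`eval_mem_pow_succ_of_map_residue_eq_zero`);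
  upstairs `ι(𝔪) ⊆ (t)`, `ι Φ₀(c) = t^m Φ₀(y′)`, so `h′ = Φ₀(y′) + t·r` with `t r ∈ 𝔪′^m`, `r ∈ 𝔪′^{m−1}` (order additivity in `R′`,
  `Helpers.mem_pow_sub_of_mul_mem_pow`), `r = Γ(y′)` for a form `Γ` of degree `m − 1`.
* `E1Free.X_notMem_directrixSpace_tangentConeIdeal_quotient` — **KEY**: if moreover `e(R/(h)) = 1` with the directrix adapted to the chart
  (`𝒯((F)) ≤ ⊕_{k ≠ j₀} κ C_k`), the point is RATIONAL (`κ` bijective) and `h′ ∉ 𝔪′^{m+1}`, then for `A′ = R′/(h′)` with generators `ȳ′`: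
  `e(A′) ≥ 1 ⇒ X_{j₀} ∉ 𝒯(J_{A′})` — the symbol of the exceptional parameter `t` is OFF the directrix hyperplane upstairs (step 1/3's
  `X_notMem_directrixSpace_of_directrixDim_pos` on `In_{𝔪′}((h′)) = (in h′)`, tree `Helpers.initialIdeal_span_singleton` +
  `tangentConeIdeal_quotient_eq_map_initialIdeal`). By the tree's `map_maximalIdeal_eq_span_of_projDirLiftsInto` this makes `t` the
  exceptional parameter AGAIN at the next point `ℙ(Dir x′)`: the step is not a satellite step (part 3/3).

[OURS · L1 W4.2; AI-written] [cite: CossartJannsenSaito2020, §2.2 (p. 24), Lemma 2.7, Def. 2.18, Thm. 9.3] [cite: Matsumura1987, Thm. 17.10]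
-/

set_option linter.dupNamespace false

noncomputable section

open IsLocalRing MvPolynomial Module
open Literature.RingTheory.MvPolynomial Literature.RingTheory.HilbertSamuel Literature.AlgebraicGeometry.Resolution
open Summit.ResolutionOfSingularities.ResolutionOfSingularities.Theorems.SigmaMaxModificationsCorridor3.Helpers

namespace Summit.ResolutionOfSingularities.ResolutionOfSingularities.Theorems.SigmaMaxModificationsCorridor3.E1Free

universe u

/-! ## Forms at scaled points -/

/-- `Φ(a·v) = a^m · Φ(v)` for a form `Φ` of degree `m` over any commutative ring. [folklore] -/
theorem eval_mul_of_isHomogeneous {S : Type u} [CommRing S] {σ : Type*} {Φ : MvPolynomial σ S} {m : ℕ}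
    (hΦ : Φ.IsHomogeneous m) (a : S) (v : σ → S) :
    eval (fun i => a * v i) Φ = a ^ m * eval v Φ := by
  classical
  simp only [MvPolynomial.eval_eq]
  rw [Finset.mul_sum]
  refine Finset.sum_congr rfl fun d hd => ?_
  have hdeg : ∑ i ∈ d.support, d i = m := by
    have h := hΦ (mem_support_iff.mp hd)
    simpa [Finsupp.weight_apply, Finsupp.sum] using h
  have hprod : ∏ i ∈ d.support, (a * v i) ^ d i = a ^ m * ∏ i ∈ d.support, v i ^ d i := by
    rw [← hdeg, ← Finset.prod_pow_eq_pow_sum, ← Finset.prod_mul_distrib]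
    exact Finset.prod_congr rfl fun i _ => mul_pow a (v i) (d i)
  rw [hprod]
  ring

/-! ## LEMMA B: the initial form of the strict transform at the origin of the `t`-chart -/

section StrictTransform

variable {R R' : Type u} [CommRing R] [IsRegularLocalRing R] [CommRing R'] [IsRegularLocalRing R']
  (ι : R →+* R') [IsLocalHom ι] {d : ℕ} (hd' : (maximalIdeal R').spanFinrank = d)
  (c : Fin d → R) (hc : Ideal.span (Set.range c) = maximalIdeal R) (j₀ : Fin d)
  (y' : Fin d → R') (hy' : Ideal.span (Set.range y') = maximalIdeal R')
  (hyj : y' j₀ = ι (c j₀)) (hyk : ∀ k, k ≠ j₀ → ι (c k) = ι (c j₀) * y' k)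

omit [IsRegularLocalRing R'] [IsLocalHom ι] in
include hc hyk in
/-- Upstairs the downstairs maximal ideal becomes principal: `ι(𝔪_R)·R′ ⊆ (ι t)`. [folklore] -/
theorem map_maximalIdeal_le_span_exceptional : (maximalIdeal R).map ι ≤ Ideal.span {ι (c j₀)} := by
  rw [← hc, Ideal.map_span, Ideal.span_le]
  rintro _ ⟨_, ⟨k, rfl⟩, rfl⟩
  by_cases hk : k = j₀
  · subst hk; exact Ideal.mem_span_singleton_self _
  · rw [SetLike.mem_coe, hyk k hk]
    exact Ideal.mul_mem_right _ _ (Ideal.mem_span_singleton_self _)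

omit [IsRegularLocalRing R] [IsLocalHom ι] in
include hd' hy' hyj in
/-- The exceptional parameter `ι t = y′_{j₀}` is a minimal generator upstairs: `ι t ∈ 𝔪′ ∖ 𝔪′²`. [folklore] -/
theorem exceptional_mem_and_notMem_sq :
    ι (c j₀) ∈ maximalIdeal R' ^ 1 ∧ ι (c j₀) ∉ maximalIdeal R' ^ (1 + 1) := by
  constructor
  · rw [pow_one, ← hyj, ← hy']
    exact Ideal.subset_span ⟨j₀, rfl⟩
  · intro hsq
    have hsum : ∑ k, (Pi.single j₀ (1 : R') : Fin d → R') k * y' k ∈ maximalIdeal R' ^ 2 := by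
      rw [Finset.sum_eq_single j₀ (fun k _ hk => by rw [Pi.single_eq_of_ne hk, zero_mul])
        (fun h => absurd (Finset.mem_univ j₀) h), Pi.single_eq_same, one_mul, hyj]
      exact hsq
    have h1 := mem_maximalIdeal_of_sum_mul_mem_sq hy' hd' hsum j₀
    rw [Pi.single_eq_same] at h1
    exact (IsLocalRing.notMem_maximalIdeal.mpr isUnit_one) h1

include hd' hc hy' hyj hyk in
/-- **LEMMA B — the initial form of the strict transform at the point `ℙ(Dir)` (origin of the `t`-chart).** With `h` of multiplicity
`m ≥ 1`, `ι h = (ι t)^m h′`, `h′ ∈ 𝔪′^m` (near), and an initial form `F` of `h` of degree `m` involving only the `C_k`, `k ≠ j₀`: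
`map κ F + X_{j₀}·G ∈ initialFormsOf y′ h′ m` for some `G` — «`in(h′) = F(Y′) + U·G`». [OURS · L1 W4.2; AI-written]
[cite: CossartJannsenSaito2020, §2.2 (p. 24), Thm. 9.3] -/
theorem exists_add_X_mul_mem_initialFormsOf {h : R} {m : ℕ} (hm1 : 1 ≤ m) {h' : R'}
    (hhh' : ι h = ι (c j₀) ^ m * h') (hh'm : h' ∈ maximalIdeal R' ^ m)
    {F : MvPolynomial (Fin d) (ResidueField R)} (hF : F ∈ initialFormsOf c h m)
    (hFsupp : F ∈ supported (ResidueField R) {i | i ≠ j₀}) :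
    ∃ G : MvPolynomial (Fin d) (ResidueField R'),
      MvPolynomial.map (ResidueField.map ι) F + X j₀ * G ∈ initialFormsOf y' h' m := by
  classical
  haveI : IsDomain R' := isDomain_of_isRegularLocalRing R'
  obtain ⟨Φ, hΦhom, hΦeval, hΦF⟩ := hF
  set t' := ι (c j₀) with ht'def
  -- (1) lift `F` with the same support
  obtain ⟨s, hs⟩ : ∃ s : ResidueField R → R, ∀ a, residue R (s a) = a :=
    ⟨Function.surjInv Ideal.Quotient.mk_surjective, Function.surjInv_eq Ideal.Quotient.mk_surjective⟩
  set Φ₀ : MvPolynomial (Fin d) R := ∑ e ∈ F.support, monomial e (s (coeff e F)) with hΦ₀def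
  have hcoeffΦ₀ : ∀ e, coeff e Φ₀ = if e ∈ F.support then s (coeff e F) else 0 := by
    intro e
    rw [hΦ₀def, coeff_sum]
    simp_rw [coeff_monomial]
    rw [Finset.sum_ite_eq']
  have hΦ₀F : MvPolynomial.map (residue R) Φ₀ = F := by
    ext e
    rw [coeff_map, hcoeffΦ₀]
    split_ifs with he
    · exact hs _
    · rw [map_zero]; exact (notMem_support_iff.mp he).symm
  have hΦ₀supp : Φ₀.support ⊆ F.support := by
    intro e he
    by_contra hne
    rw [MvPolynomial.mem_support_iff, hcoeffΦ₀, if_neg hne] at he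
    exact he rfl
  have hFhom : F.IsHomogeneous m := by rw [← hΦF]; exact hΦhom.map _
  have hΦ₀hom : Φ₀.IsHomogeneous m := fun e he =>
    hFhom (MvPolynomial.mem_support_iff.mp (hΦ₀supp (MvPolynomial.mem_support_iff.mpr he)))
  have hΦ₀vars : ∀ i ∈ Φ₀.vars, i ≠ j₀ := by
    intro i hi
    have hiF : i ∈ F.vars := by
      rw [MvPolynomial.mem_vars_iff_mem_support] at hi ⊢
      obtain ⟨e, he, hie⟩ := hi
      exact ⟨e, hΦ₀supp he, hie⟩
    exact (mem_supported.mp hFsupp) hiF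
  -- (2) `h − Φ₀(c) ∈ 𝔪^{m+1}`
  have hr₀ : h - eval c Φ₀ ∈ maximalIdeal R ^ (m + 1) := by
    have h1 : eval c (Φ - Φ₀) ∈ maximalIdeal R ^ (m + 1) :=
      Literature.RingTheory.HilbertSamuel.eval_mem_pow_succ_of_map_residue_eq_zero c hc (hΦhom.sub hΦ₀hom) (by rw [map_sub, hΦF, hΦ₀F, sub_self])
    rwa [map_sub, hΦeval] at h1
  -- (3) upstairs: `ι(h − Φ₀(c)) = t'^{m+1} r`
  have hιm : (maximalIdeal R).map ι ≤ Ideal.span {t'} := map_maximalIdeal_le_span_exceptional ι c hc j₀ y' hyk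
  have hr : ∃ r : R', ι (h - eval c Φ₀) = t' ^ (m + 1) * r := by
    have h1 : ι (h - eval c Φ₀) ∈ ((maximalIdeal R).map ι) ^ (m + 1) := by
      rw [← Ideal.map_pow]; exact Ideal.mem_map_of_mem ι hr₀
    have h2 := Ideal.pow_right_mono hιm (m + 1) h1
    rw [Ideal.span_singleton_pow, Ideal.mem_span_singleton'] at h2
    obtain ⟨r, hr⟩ := h2
    exact ⟨r, by rw [← hr, mul_comm]⟩
  obtain ⟨r, hr⟩ := hr
  -- (4) `ι Φ₀(c) = t'^m Φ₀'(y')`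
  set Φ₀' : MvPolynomial (Fin d) R' := MvPolynomial.map ι Φ₀ with hΦ₀'def
  have hΦ₀'hom : Φ₀'.IsHomogeneous m := hΦ₀hom.map ι
  have hevalι : ι (eval c Φ₀) = eval (ι ∘ c) Φ₀' := by
    rw [hΦ₀'def, eval_map]
    change ι (eval₂ (RingHom.id R) c Φ₀) = _
    rw [eval₂_comp_left, RingHom.comp_id]
  have hscale : eval (ι ∘ c) Φ₀' = t' ^ m * eval y' Φ₀' := by
    have h1 : eval (ι ∘ c) Φ₀' = eval (fun k => t' * y' k) Φ₀' := by
      refine MvPolynomial.hom_congr_vars (f₁ := eval (ι ∘ c)) (f₂ := eval fun k => t' * y' k) (by ext a; simp)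
        (fun i hi _ => ?_) rfl
      have hi' : i ∈ Φ₀.vars := vars_map _ _ hi
      have hij : i ≠ j₀ := hΦ₀vars i hi'
      rw [eval_X, eval_X, Function.comp_apply, hyk i hij]
    rw [h1, eval_mul_of_isHomogeneous hΦ₀'hom]
  -- (5) cancel `t'^m`: `h' = Φ₀'(y') + t' r`
  obtain ⟨ht'1, ht'2⟩ := exceptional_mem_and_notMem_sq ι hd' c j₀ y' hy' hyj
  have ht'0 : t' ≠ 0 := fun h0 => ht'2 (by rw [← ht'def, h0]; exact zero_mem _)
  have hkey : h' = eval y' Φ₀' + t' * r := by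
    have h1 : t' ^ m * h' = t' ^ m * (eval y' Φ₀' + t' * r) := by
      rw [← hhh', mul_add, ← hscale, ← hevalι, ← mul_assoc, ← pow_succ, ← hr, map_sub]
      ring
    exact mul_left_cancel₀ (pow_ne_zero m ht'0) h1
  -- (6) `r ∈ 𝔪'^{m-1}`, a form `Γ` of degree `m − 1`
  have hrm : r ∈ maximalIdeal R' ^ (m - 1) := by
    have h1 : r * t' ∈ maximalIdeal R' ^ m := by
      have h2 : r * t' = h' - eval y' Φ₀' := by rw [hkey]; ring
      rw [h2]
      exact sub_mem hh'm (eval_mem_pow_of_isHomogeneous y' hy' hΦ₀'hom)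
    exact mem_pow_sub_of_mul_mem_pow hd' y' hy' ht'1 ht'2 h1
  obtain ⟨Γ, hΓhom, hΓeval⟩ := exists_isHomogeneous_of_mem_span_pow y' (m - 1) (by rw [hy']; exact hrm)
  -- (7) the exact form `Φ₀' + X_{j₀} Γ` of degree `m` representing `h'`
  refine ⟨MvPolynomial.map (residue R') Γ, Φ₀' + X j₀ * Γ, ?_, ?_, ?_⟩
  · have hXΓ : (X j₀ * Γ : MvPolynomial (Fin d) R').IsHomogeneous m := by
      have := (isHomogeneous_X R' j₀).mul hΓhom
      rwa [show 1 + (m - 1) = m by omega] at this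
    exact hΦ₀'hom.add hXΓ
  · rw [map_add, map_mul, eval_X, hΓeval, hyj, hkey]
  · rw [map_add, map_mul, map_X, hΦ₀'def, MvPolynomial.map_map]
    congr 1
    have hcomp : (residue R').comp ι = (ResidueField.map ι).comp (residue R) :=
      RingHom.ext fun a => (ResidueField.map_residue ι a).symm
    rw [hcomp, ← MvPolynomial.map_map, hΦ₀F]

end StrictTransform

/-! ## KEY: the exceptional variable is off the directrix upstairs -/

section Key

variable {k k' : Type u} [Field k] [Field k'] {d : ℕ}

/-- Linear combinations of variables are mapped to linear combinations of the same variables by a change of ground field. [folklore] -/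
theorem map_mem_span_X_image (κ : k →+* k') (S : Set (Fin d)) {L : MvPolynomial (Fin d) k}
    (hL : L ∈ Submodule.span k (X '' S : Set (MvPolynomial (Fin d) k))) :
    MvPolynomial.map κ L ∈ Submodule.span k' (X '' S : Set (MvPolynomial (Fin d) k')) := by
  induction hL using Submodule.span_induction with
  | mem x hx =>
    obtain ⟨i, hi, rfl⟩ := hx
    rw [map_X]
    exact Submodule.subset_span ⟨i, hi, rfl⟩
  | zero => rw [map_zero]; exact zero_mem _
  | add x y _ _ hx hy => rw [map_add]; exact add_mem hx hy
  | smul a x _ hx =>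
    rw [smul_eq_C_mul, map_mul, map_C, ← smul_eq_C_mul]
    exact Submodule.smul_mem _ _ hx

/-- The chart-adapted directrix hypothesis `𝒯((F)) ≤ ⊕_{i ≠ j} κ X_i`, `e((F)) = 1` is stable under an isomorphism of the ground field
(rational points). [cite: CossartJannsenSaito2020, Lemma 2.7, Lemma 2.10 (2)] -/
theorem directrixSpace_map_eq_span_X (κ : k →+* k') (hκ : Function.Bijective κ) {j : Fin d} {F : MvPolynomial (Fin d) k}
    (hle : directrixSpace (Ideal.span {F}) ≤ Submodule.span k (X '' {i | i ≠ j}))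
    (hdim : directrixDim (Ideal.span {F}) = 1) :
    directrixSpace (Ideal.span {MvPolynomial.map κ F}) = Submodule.span k' (X '' {i | i ≠ j}) := by
  have hmap : Ideal.span {MvPolynomial.map κ F} = (Ideal.span {F}).map (MvPolynomial.map κ) := by
    rw [Ideal.map_span, Set.image_singleton]
  refine directrixSpace_eq_span_X_of_supported ?_ ?_
  · intro L hL
    rw [hmap, ← SetLike.mem_coe, coe_directrixSpace_map_of_bijective κ hκ] at hL
    obtain ⟨L₀, hL₀, rfl⟩ := hL
    exact map_mem_span_X_image κ _ (hle hL₀)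
  · rw [hmap, directrixDim_map_eq_of_bijective κ hκ, hdim]

variable {R' : Type u} [CommRing R'] [IsRegularLocalRing R'] (hd' : (maximalIdeal R').spanFinrank = d)
  (y' : Fin d → R') (hy' : Ideal.span (Set.range y') = maximalIdeal R')

include hd' hy' in
/-- **KEY — the exceptional variable is off the directrix of the strict transform.** `R′` regular local with regular parameters `y′`,
`h′ ∈ 𝔪′^m ∖ 𝔪′^{m+1}` with an initial form `P = F′ + X_{j₀}·G` where `F′` is a non-zero form of degree `m` with `𝒯((F′)) = ⊕_{i ≠ j₀} κ′ X_i`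
(LEMMA B's output, the directrix hypothesis transported by `directrixSpace_map_eq_span_X`); `A′ := R′/(h′)` with the induced generators.
Then `e(A′) ≥ 1 ⇒ X_{j₀} ∉ 𝒯(J_{A′})`. [OURS · L1 W4.2; AI-written] [cite: CossartJannsenSaito2020, §2.2 (p. 24), Lemma 2.7, Def. 2.18, Thm. 9.3] -/
theorem X_notMem_directrixSpace_tangentConeIdeal_quotient {j₀ : Fin d} {h' : R'} {m : ℕ}
    (hh'm : h' ∈ maximalIdeal R' ^ m) (hh'm1 : h' ∉ maximalIdeal R' ^ (m + 1))
    {F' G : MvPolynomial (Fin d) (ResidueField R')} (hF' : F'.IsHomogeneous m) (hF'0 : F' ≠ 0)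
    (hTF' : directrixSpace (Ideal.span {F'}) = Submodule.span (ResidueField R') (X '' {i | i ≠ j₀}))
    (hP : F' + X j₀ * G ∈ initialFormsOf y' h' m) [Nontrivial (R' ⧸ Ideal.span {h'})]
    (hpos : 0 < directrixDim (tangentConeIdeal (fun i => Ideal.Quotient.mk (Ideal.span {h'}) (y' i))
      (span_range_mk_comp_eq y' hy' (Ideal.span {h'})))) :
    (X j₀ : MvPolynomial (Fin d) (ResidueField (R' ⧸ Ideal.span {h'}))) ∉
      directrixSpace (tangentConeIdeal (fun i => Ideal.Quotient.mk (Ideal.span {h'}) (y' i))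
        (span_range_mk_comp_eq y' hy' (Ideal.span {h'}))) := by
  set J : Ideal R' := Ideal.span {h'} with hJ
  set κ₁ := ResidueField.map (Ideal.Quotient.mk J) with hκ₁
  have hκ₁ : Function.Bijective κ₁ := residueField_map_mk_bijective J
  -- `J_{A'} = (In(h')) = (P)` transported along `κ₁`
  have hP0 : F' + X j₀ * G ≠ 0 := ne_zero_of_mem_initialFormsOf y' hy' hP hh'm1
  have hPhom : (F' + X j₀ * G).IsHomogeneous m := isHomogeneous_of_mem_initialFormsOf y' hP
  have hIn : initialIdeal y' J = Ideal.span {F' + X j₀ * G} := initialIdeal_span_singleton hd' y' hy' hh'm hh'm1 hP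
  have hTC : tangentConeIdeal (fun i => Ideal.Quotient.mk J (y' i)) (span_range_mk_comp_eq y' hy' J) =
      (Ideal.span {F' + X j₀ * G}).map (MvPolynomial.map κ₁) := by
    rw [tangentConeIdeal_quotient_eq_map_initialIdeal y' hy' J, hIn]
  -- `X_{j₀} ∈ 𝒯(J_{A'})` iff `X_{j₀} ∈ 𝒯((P))`
  intro hX
  rw [hTC, ← SetLike.mem_coe, coe_directrixSpace_map_of_bijective κ₁ hκ₁] at hX
  obtain ⟨L, hL, hLX⟩ := hX
  have hLX' : L = X j₀ := by
    have hinj : Function.Injective (MvPolynomial.map (σ := Fin d) κ₁) := map_injective κ₁ hκ₁.1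
    exact hinj (hLX.trans (map_X κ₁ j₀).symm)
  subst hLX'
  -- dimension: `e(J_{A'}) = e((P))`
  have hpos' : 0 < directrixDim (Ideal.span {F' + X j₀ * G}) := by
    rwa [hTC, Ideal.map_span, Set.image_singleton, ← Ideal.map_span_singleton_aux,
      directrixDim_map_eq_of_bijective κ₁ hκ₁] at hpos
  exact X_notMem_directrixSpace_of_directrixDim_pos hF' hF'0 hTF' hPhom hP0 hpos' hL
  where
  /-- `(map κ) '' {P}` packaging: `span {map κ P} = (span {P}).map (map κ)`. [folklore] -/
  Ideal.map_span_singleton_aux {P : MvPolynomial (Fin d) (ResidueField R')}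
      {κ : ResidueField R' →+* ResidueField (R' ⧸ Ideal.span {h'})} :
      (Ideal.span {P}).map (MvPolynomial.map κ) = Ideal.span {MvPolynomial.map κ P} := by
    rw [Ideal.map_span, Set.image_singleton]

end Key

end Summit.ResolutionOfSingularities.ResolutionOfSingularities.Theorems.SigmaMaxModificationsCorridor3.E1Free

end
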